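import Literature.MathematicalPhysics.QuantumLattice.HubbardHalfFilledSector
import Literature.MathematicalPhysics.QuantumLattice.SectorSpectrum
import Literature.MathematicalPhysics.QuantumLattice.Su2Multiplet
import HarnessLib

/-!
# Proof of Lieb's Theorem 2 (`HubbardWave0.lieb_repulsive_halfFilling`)

Trunk T-QLATTICE, family `hubbard`. Discharge `lieb_repulsive_halfFilling_holds` of the named
fact `Literature.MathematicalPhysics.QuantumLattice.lieb_repulsive_halfFilling` of `HubbardWave0`: E. H. Lieb, *Two theorems on the
Hubbard model*, Phys. Rev. Lett. **62** (1989) 1201 (Erratum 1927), **Theorem 2** — for `U > 0`,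
`t ≠ 0`, `|Λ|` even, `G` connected and bipartite with colour class `A`, at half filling
`N = |Λ|` every ground state has total spin `S = ||A| - |B||/2` (`S²ψ = S(S+1)ψ`) and the ground
eigenspace of the `N`-particle sector has dimension `2S + 1`.

## Proof architecture (files)

1. `LiebSpinReflection` (Theorem 1 effort) + `SpinReflectionPositivity` — Lieb's matrix lemma
   (`IsLiebSystem.exists_posDef_eq_smul`), packaged on the ground space of the Hermitian matrix
   `liebMatrix` with irreducibility derived from separation + connectivity.
2. `HubbardWave0LiebProofs` (Theorem 1: symmetries of `H`, bilinear calculus), `HubbardLiebBasis`,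
   `HubbardHalfFilledSector` — the site-major Jordan–Wigner bookkeeping
   identifying the `N_↑ = n`, `N_↓ = n` sector with `n`-subset coefficient matrices so that `H`
   becomes Lieb's operator plus `U n` (hole–particle transformation, eqs. (4)–(5)), token-sliding
   connectivity, and the spin-`J` reference state `Ξ`.
3. `SectorSpectrum` — the sector ground energy `groundEnergy H N` is attained and is a lower bound
   for the Rayleigh quotient on `N`-particle vectors.
4. `Su2Multiplet` — structure of `su(2)`-stable subspaces with one-dimensional weight-zero part.
5. This file (namespace `Literature.Hubbard.LiebTwo`, final theorem in `Literature.Hubbard`): the ground space `V = ker(H - E₀) ∩ ker(N̂ - N)` is stable under `S^±`, decomposes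
   into `S^z`-weight spaces (`groundSector_weight_decomposition`), hence meets `S^z = 0`
   (`su2_multiplet` (1)); on `S^z = 0` it consists of `Φ(W)` with `W` an eigenmatrix of Lieb's
   operator, so `E₀ = e + U n` and `V ∩ {S^z = 0} = ℂ Φ(W₀)` (uniqueness); `S² Φ(W₀) = J(J+1)Φ(W₀)`
   by the overlap with `Ξ`; `su2_multiplet` (2) gives `dim V = 2J+1` and `S² = J(J+1)` on `V`
   (`lieb_repulsive_halfFilling_core`); finally the colour class is normalised to `|A| ≤ |B|`.

The determination of the spin value differs from the printed proof (Lieb: continuity in `U` plus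
the Lieb–Mattis theorem for the large-`U` Heisenberg model); here it is the overlap argument of
Lieb's Theorem 1(a) with an explicit spin-`J` state. The statement proved is exactly the vendored
one. Source read: reprint of the PRL in A. Montorsi (ed.), *The Hubbard Model — a reprint volume*,
pp. 111–119 (`book:editornd-hubbard-model`).
-/

noncomputable section

namespace Literature.MathematicalPhysics.QuantumLattice.LiebTwo

open Matrix Finset LiebThm1
open scoped ComplexOrder

attribute [local simp] Literature.MathematicalPhysics.QuantumLattice.star_jwSign

section AssemblyPrelim

variable {Λ : Type*} [LinearOrder Λ] [Fintype Λ]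

/-- `N` commutes with `S⁺` (a spin flip keeps the particle number). [folklore] -/
theorem totalNumber_mul_spinPlus :
    (totalNumber * spinPlus : Matrix (Finset (Orb Λ)) _ ℂ) = spinPlus * totalNumber := by
  rw [← Literature.MathematicalPhysics.QuantumLattice.totalNumberOp_eq_totalNumber, Literature.MathematicalPhysics.QuantumLattice.totalNumberOp_eq_diagonal]
  refine diagonal_mul_spinPlus_of_flip_invariant _ fun z s h0 h1 => ?_
  have h1' : orb z 1 ∉ s.erase (orb z 0) := fun h' => h1 (mem_of_mem_erase h')
  rw [card_insert_of_notMem h1', card_erase_of_mem h0, Nat.sub_add_cancel (card_pos.2 ⟨_, h0⟩)]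

/-- `N` commutes with `S⁻`. [folklore] -/
theorem totalNumber_mul_spinMinus :
    (totalNumber * Literature.MathematicalPhysics.QuantumLattice.spinMinus : Matrix (Finset (Orb Λ)) _ ℂ) = Literature.MathematicalPhysics.QuantumLattice.spinMinus * totalNumber := by
  have hN : (totalNumber : Matrix (Finset (Orb Λ)) _ ℂ)ᴴ = totalNumber := by
    rw [← Literature.MathematicalPhysics.QuantumLattice.totalNumberOp_eq_totalNumber, Literature.MathematicalPhysics.QuantumLattice.totalNumberOp_eq_diagonal, diagonal_conjTranspose]
    congr 1; funext s; simp
  have h := congrArg conjTranspose (totalNumber_mul_spinPlus (Λ := Λ))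
  rw [conjTranspose_mul, conjTranspose_mul, hN] at h
  exact h.symm

/-- `S^z` is Hermitian. [folklore] -/
theorem spinZ_conjTranspose : (HubbardWave0.spinZ : Matrix (Finset (Orb Λ)) _ ℂ)ᴴ = HubbardWave0.spinZ := by
  rw [spinZ_eq_diagonal, diagonal_conjTranspose]
  congr 1; funext s
  simp

/-- `S²` is Hermitian. [folklore] -/
theorem spinSq_conjTranspose : (spinSq : Matrix (Finset (Orb Λ)) _ ℂ)ᴴ = spinSq := by
  rw [spinSq, conjTranspose_add, conjTranspose_mul, spinZ_conjTranspose, conjTranspose_smul, conjTranspose_add,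
    conjTranspose_mul, conjTranspose_mul, conjTranspose_conjTranspose]
  congr 1
  congr 1
  simp

/-- The Hubbard spin operators form an `su(2)` triple. [folklore] -/
theorem isSu2Triple_spin :
    Literature.MathematicalPhysics.QuantumLattice.IsSu2Triple (spinPlus : Matrix (Finset (Orb Λ)) _ ℂ) Literature.MathematicalPhysics.QuantumLattice.spinMinus HubbardWave0.spinZ :=
  Literature.MathematicalPhysics.QuantumLattice.IsSu2Triple.mk' rfl spinZ_conjTranspose spinPlus_mul_spinMinus_sub spinZ_mul_spinPlus_sub

/-- `HubbardWave0.spinSq` is the Casimir of the spin triple. [folklore] -/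
theorem su2Casimir_spin_eq_spinSq :
    Literature.MathematicalPhysics.QuantumLattice.su2Casimir (spinPlus : Matrix (Finset (Orb Λ)) _ ℂ) Literature.MathematicalPhysics.QuantumLattice.spinMinus HubbardWave0.spinZ = spinSq := rfl

/-- `N`-particle vectors are the `N`-eigenvectors of the number operator. [folklore] -/
theorem isNParticle_iff_totalNumber (N : ℕ) (ψ : Fock (Orb Λ)) :
    IsNParticle N ψ ↔ totalNumber *ᵥ ψ = (N : ℂ) • ψ := by
  constructor
  · intro h; funext s
    rw [totalNumber_mulVec, Pi.smul_apply, smul_eq_mul]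
    by_cases hs : s.card = N
    · rw [hs]
    · rw [h s hs, mul_zero, mul_zero]
  · intro h s hs
    have h' := congrFun h s
    rw [totalNumber_mulVec, Pi.smul_apply, smul_eq_mul, ← sub_eq_zero, ← sub_mul, mul_eq_zero] at h'
    rcases h' with h' | h'
    · exact absurd (by exact_mod_cast (sub_eq_zero.1 h')) hs
    · exact h'

/-- An operator commuting with `N` preserves the `N`-particle sector. [folklore] -/
theorem isNParticle_mulVec_of_commute {N : ℕ} {ψ : Fock (Orb Λ)} (h : IsNParticle N ψ)
    {B : Matrix (Finset (Orb Λ)) (Finset (Orb Λ)) ℂ} (hB : totalNumber * B = B * totalNumber) :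
    IsNParticle N (B *ᵥ ψ) := by
  rw [isNParticle_iff_totalNumber] at h ⊢
  rw [mulVec_mulVec, hB, ← mulVec_mulVec, h, mulVec_smul]

/-- `S^z` commutes with `N` (both diagonal). [folklore] -/
theorem totalNumber_mul_spinZ : (totalNumber * HubbardWave0.spinZ : Matrix (Finset (Orb Λ)) _ ℂ) = HubbardWave0.spinZ * totalNumber := by
  rw [← Literature.MathematicalPhysics.QuantumLattice.totalNumberOp_eq_totalNumber, Literature.MathematicalPhysics.QuantumLattice.totalNumberOp_eq_diagonal, spinZ_eq_diagonal,
    diagonal_mul_diagonal, diagonal_mul_diagonal]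
  congr 1; funext s; ring

variable (G : SimpleGraph Λ) [DecidableRel G.Adj]

/-- The ground eigenspace in the `N`-particle sector, as it appears in `lieb_repulsive_halfFilling`:
membership means `Hψ = E₀ψ` and `ψ` is an `N`-particle vector. [folklore] -/
theorem mem_groundSector_iff (t U : ℝ) (N : ℕ) (E : ℝ) (ψ : Fock (Orb Λ)) :
    ψ ∈ LinearMap.ker (Matrix.toLin' (hamiltonian G t U - ((E : ℝ) : ℂ) • 1)) ⊓
        LinearMap.ker (Matrix.toLin' (totalNumber - (N : ℂ) • (1 : Matrix _ _ ℂ))) ↔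
      hamiltonian G t U *ᵥ ψ = (E : ℂ) • ψ ∧ IsNParticle N ψ := by
  rw [Submodule.mem_inf, LinearMap.mem_ker, LinearMap.mem_ker, Matrix.toLin'_apply, Matrix.toLin'_apply,
    sub_mulVec, sub_mulVec, smul_mulVec, smul_mulVec, one_mulVec, sub_eq_zero, sub_eq_zero,
    isNParticle_iff_totalNumber]

end AssemblyPrelim

section Assembly

variable {Λ : Type*} [LinearOrder Λ] [Fintype Λ] (G : SimpleGraph Λ) [DecidableRel G.Adj]

/-- Weight decomposition of the ground sector: an `N = 2n`-particle eigenvector of `H` is the sum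
of its restrictions to the `S^z = m` sectors, each again an eigenvector (the Hamiltonian conserves
`N_↑` and `N_↓`). [folklore] -/
theorem groundSector_weight_decomposition (t U : ℝ) (n : ℕ) (E : ℝ) {ψ : Fock (Orb Λ)}
    (hψ : hamiltonian G t U *ᵥ ψ = (E : ℂ) • ψ ∧ IsNParticle (2 * n) ψ) :
    ∃ (S : Finset ℤ) (w : ℤ → Fock (Orb Λ)),
      (∀ m ∈ S, (hamiltonian G t U *ᵥ w m = (E : ℂ) • w m ∧ IsNParticle (2 * n) (w m)) ∧
        HubbardWave0.spinZ *ᵥ w m = (m : ℂ) • w m) ∧ ψ = ∑ m ∈ S, w m := by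
  classical
  set wt : Finset (Orb Λ) → ℤ := fun s => ((upPart s).card : ℤ) - (downPart s).card with hwt
  set w : ℤ → Fock (Orb Λ) := fun m s => if wt s = 2 * m then ψ s else 0 with hw
  have hwt_eq : ∀ {s s' : Finset (Orb Λ)}, hamiltonian G t U s s' ≠ 0 → wt s = wt s' := by
    intro s s' h
    obtain ⟨h1, h2⟩ := preservesSectors_hamiltonian G t U _ _ h
    simp only [hwt, h1, h2]
  refine ⟨Finset.Icc (-(n : ℤ)) n, w, fun m _ => ⟨⟨?_, ?_⟩, ?_⟩, ?_⟩
  · -- eigenvector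
    funext s
    simp only [Pi.smul_apply, smul_eq_mul, mulVec, dotProduct]
    have hterm : ∀ s', hamiltonian G t U s s' * w m s' =
        if wt s = 2 * m then hamiltonian G t U s s' * ψ s' else 0 := by
      intro s'
      simp only [hw]
      by_cases hH : hamiltonian G t U s s' = 0
      · simp [hH]
      · rw [hwt_eq hH]
        split_ifs <;> simp
    rw [Finset.sum_congr rfl fun s' _ => hterm s']
    simp only [hw]
    split_ifs with hs
    · have := congrFun hψ.1 s
      simp only [mulVec, dotProduct, Pi.smul_apply, smul_eq_mul] at this
      exact this
    · rw [Finset.sum_const_zero, mul_zero]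
  · -- N-particle
    intro s hs
    simp only [hw]
    split_ifs
    · exact hψ.2 s hs
    · rfl
  · -- weight
    funext s
    rw [spinZ_mulVec_apply, Pi.smul_apply, smul_eq_mul]
    simp only [hw]
    split_ifs with hs
    · have hc : (((upPart s).card : ℂ) - (downPart s).card) = ((wt s : ℤ) : ℂ) := by simp [hwt]
      rw [hc, hs]; push_cast; ring
    · simp
  · -- completeness
    funext s
    rw [Finset.sum_apply]
    by_cases hψs : ψ s = 0
    · rw [hψs]; symm
      refine Finset.sum_eq_zero fun m _ => ?_
      simp only [hw]; split_ifs <;> simp [hψs]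
    · have hcard : s.card = 2 * n := by by_contra h; exact hψs (hψ.2 s h)
      have hsum : (upPart s).card + (downPart s).card = 2 * n := by
        rw [← card_pairSet, pairSet_upPart_downPart, hcard]
      set m₀ : ℤ := ((upPart s).card : ℤ) - n with hm₀
      have hwt₀ : wt s = 2 * m₀ := by
        simp only [hwt, hm₀]
        have : ((downPart s).card : ℤ) = 2 * n - (upPart s).card := by omega
        rw [this]; ring
      rw [Finset.sum_eq_single m₀]
      · simp only [hw]; rw [if_pos hwt₀]
      · intro m _ hm
        simp only [hw]; rw [if_neg]; rw [hwt₀]; omega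
      · intro hm
        exfalso; apply hm
        rw [Finset.mem_Icc, hm₀]
        constructor <;> omega

/-- `Φ 0 = 0`. [folklore] -/
theorem toFockN_zero (A : Finset Λ) (n : ℕ) : toFockN A n (0 : Matrix (Config Λ n) (Config Λ n) ℂ) = 0 := by
  have h := toFockN_smul A n (0 : ℂ) (0 : Matrix (Config Λ n) (Config Λ n) ℂ)
  rwa [zero_smul, zero_smul] at h

/-- **Lieb's Theorem 2, core statement** (bipartition normalised to `|A| ≤ |B|`, `|Λ| = 2n`,
`|A| + J = n`): the ground eigenspace of the Hubbard Hamiltonian in the half-filled sector has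
dimension `2J + 1` and total spin `J`. Proof: Lieb's spin-space reflection positivity gives a
unique, positive definite ground state `Φ(W₀)` in the `S^z = 0` sector (`exists_posDef_groundState`,
via `hamiltonian_mulVec_toFockN`); every eigen-multiplet meets `S^z = 0` (`su2_multiplet` (1)), so the
sector ground energy is the `S^z = 0` ground energy and the weight-zero part of the ground space
is the line through `Φ(W₀)`; its spin is `J` by the overlap with the reference state `Ξ`
(`refState_overlap_ne_zero`, `spinSq_mulVec_refState` — replacing Lieb's continuity argument);
`su2_multiplet` (2) concludes. [cite: LiebPRL1989, Theorem 2] -/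
theorem lieb_repulsive_halfFilling_core (hG : G.Connected) (A : Finset Λ)
    (hA : ∀ x y : Λ, G.Adj x y → (x ∈ A ↔ y ∉ A)) {n : ℕ} (hΛ : Fintype.card Λ = 2 * n)
    {J : ℕ} (hAJ : A.card + J = n) (t U : ℝ) (ht : t ≠ 0) (hU : 0 < U) :
    Module.finrank ℂ ↥(LinearMap.ker (Matrix.toLin' (hamiltonian G t U -
        ((groundEnergy (hamiltonian G t U) (2 * n) : ℝ) : ℂ) • 1)) ⊓
        LinearMap.ker (Matrix.toLin' (totalNumber - ((2 * n : ℕ) : ℂ) • (1 : Matrix _ _ ℂ)))) = 2 * J + 1 ∧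
      ∀ ψ ∈ LinearMap.ker (Matrix.toLin' (hamiltonian G t U -
          ((groundEnergy (hamiltonian G t U) (2 * n) : ℝ) : ℂ) • 1)) ⊓
          LinearMap.ker (Matrix.toLin' (totalNumber - ((2 * n : ℕ) : ℂ) • (1 : Matrix _ _ ℂ))),
        spinSq *ᵥ ψ = ((J : ℂ) * (J + 1)) • ψ := by
  classical
  set H := hamiltonian G t U with hHdef
  set N := 2 * n with hNdef
  set E₀ := groundEnergy H N with hE₀
  set V := LinearMap.ker (Matrix.toLin' (H - ((E₀ : ℝ) : ℂ) • 1)) ⊓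
    LinearMap.ker (Matrix.toLin' (totalNumber - (N : ℂ) • (1 : Matrix (Finset (Orb Λ)) _ ℂ))) with hVdef
  have hHerm : H.IsHermitian := hamiltonian_isHermitian G t U
  have hmemV : ∀ ψ, ψ ∈ V ↔ H *ᵥ ψ = (E₀ : ℂ) • ψ ∧ IsNParticle N ψ := fun ψ =>
    mem_groundSector_iff G t U N E₀ ψ
  -- spectral theory in the `N`-particle sector
  have hK : ∀ v, v ∈ Literature.MathematicalPhysics.QuantumLattice.nParticleSubmodule (ι := Orb Λ) N ↔ ∀ s, ¬ (s.card = N) → v s = 0 :=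
    fun v => Iff.rfl
  have hE₀' : E₀ = H.minEnergyOn (Literature.MathematicalPhysics.QuantumLattice.nParticleSubmodule N) :=
    groundEnergy_eq_minEnergyOn H N _ fun ψ => Iff.rfl
  have hp : ∃ s : Finset (Orb Λ), s.card = N := ⟨pairSet univ ∅, by rw [card_pairSet, card_univ, hΛ]; simp [hNdef]⟩
  have hinv : ∀ s s' : Finset (Orb Λ), ¬ s.card = N → s'.card = N → H s s' = 0 := by
    intro s s' hs hs'
    by_contra hne
    obtain ⟨h1, h2⟩ := preservesSectors_hamiltonian G t U _ _ hne
    apply hs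
    rw [← pairSet_upPart_downPart s, card_pairSet, h1, h2, ← card_pairSet, pairSet_upPart_downPart]
    exact hs'
  obtain ⟨⟨v₁, hv₁K, hv₁0, hv₁eq⟩, hvar⟩ := Literature.MathematicalPhysics.QuantumLattice.sector_groundState H hHerm (fun s => s.card = N)
    hp hinv (Literature.MathematicalPhysics.QuantumLattice.nParticleSubmodule N) hK
  rw [← hE₀'] at hv₁eq hvar
  have hv₁V : v₁ ∈ V := (hmemV v₁).2 ⟨hv₁eq, hv₁K⟩
  have hVne : V ≠ ⊥ := fun h => hv₁0 (by rw [h] at hv₁V; exact (Submodule.mem_bot ℂ).1 hv₁V)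
  -- invariance of `V` under the spin operators
  have hPV : ∀ ψ ∈ V, spinPlus *ᵥ ψ ∈ V := by
    intro ψ hψ
    rw [hmemV] at hψ ⊢
    refine ⟨?_, isNParticle_mulVec_of_commute hψ.2 totalNumber_mul_spinPlus⟩
    rw [mulVec_mulVec, hHdef, (hamiltonian_commute_spinPlus G t U).eq, ← mulVec_mulVec, ← hHdef, hψ.1, mulVec_smul]
  have hMV : ∀ ψ ∈ V, Literature.MathematicalPhysics.QuantumLattice.spinMinus *ᵥ ψ ∈ V := by
    intro ψ hψ
    rw [hmemV] at hψ ⊢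
    refine ⟨?_, isNParticle_mulVec_of_commute hψ.2 totalNumber_mul_spinMinus⟩
    rw [mulVec_mulVec, hHdef, (hamiltonian_commute_spinMinus G t U).eq, ← mulVec_mulVec, ← hHdef, hψ.1,
      mulVec_smul]
  have hZV : ∀ ψ ∈ V, HubbardWave0.spinZ *ᵥ ψ ∈ V := by
    intro ψ hψ
    rw [hmemV] at hψ ⊢
    refine ⟨?_, isNParticle_mulVec_of_commute hψ.2 totalNumber_mul_spinZ⟩
    rw [mulVec_mulVec, hHdef, (hamiltonian_isHermitian_and_commute_holds G t U).2.2, ← mulVec_mulVec, ← hHdef,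
      hψ.1, mulVec_smul]
  have hwt : ∀ v ∈ V, ∃ (S : Finset ℤ) (w : ℤ → Fock (Orb Λ)),
      (∀ m ∈ S, w m ∈ V ∧ HubbardWave0.spinZ *ᵥ w m = (m : ℂ) • w m) ∧ v = ∑ m ∈ S, w m := by
    intro v hv
    obtain ⟨S, w, hw, hsum⟩ := groundSector_weight_decomposition G t U n E₀ ((hmemV v).1 hv)
    exact ⟨S, w, fun m hm => ⟨(hmemV _).2 (hw m hm).1, (hw m hm).2⟩, hsum⟩
  obtain ⟨hC1, hC2⟩ := Literature.MathematicalPhysics.QuantumLattice.IsSu2Triple.su2_multiplet isSu2Triple_spin V hPV hMV hwt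
  -- Lieb's lemma in the `S^z = 0` sector
  have hn : n ≤ (univ : Finset Λ).card := by rw [card_univ, hΛ]; omega
  obtain ⟨α₀, -, hα₀⟩ := Finset.exists_subset_card_eq hn
  haveI : Nonempty (Config Λ n) := ⟨⟨α₀, hα₀⟩⟩
  obtain ⟨W₀, hW₀pd, hW₀gs, huniq⟩ := exists_posDef_groundState G hG ht hU n
  have hT : (liebK G t n).IsHermitian ∧ (liebK G t n).IsSymm := ⟨liebK_conjTranspose t n, liebK_transpose G t n⟩
  set LM := Literature.MathematicalPhysics.QuantumLattice.SpinReflection.liebMatrix (liebK G t n) (occInd n) (-U) with hLM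
  set e := LM.groundEnergy with he
  set ψ₀ := toFockN A n W₀ with hψ₀def
  -- properties of `Φ`
  have hΦN : ∀ W, IsNParticle N (toFockN A n W) := by
    intro W s hs
    by_contra h
    obtain ⟨h1, h2⟩ := toFockN_apply_ne_zero A n W h
    apply hs
    rw [Finset.card_compl, hΛ, hNdef] at h2
    have hle : (downPart s).card ≤ 2 * n := by rw [← hNdef, ← hΛ]; exact Finset.card_le_univ _
    rw [← pairSet_upPart_downPart s, card_pairSet, h1, hNdef]
    omega
  have hΦH : ∀ W, H *ᵥ toFockN A n W =
      toFockN A n (Literature.MathematicalPhysics.QuantumLattice.liebOp (liebK G t n) (fun x => Literature.MathematicalPhysics.QuantumLattice.SpinReflection.rdiag (occInd n x)) (-U) W) +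
        ((U : ℂ) * n) • toFockN A n W := hamiltonian_mulVec_toFockN G A hA t U n
  have hΦZ0 : ∀ W, HubbardWave0.spinZ *ᵥ toFockN A n W = 0 := by
    intro W; funext s
    rw [spinZ_mulVec_apply, Pi.zero_apply]
    by_cases h : toFockN A n W s = 0
    · rw [h, mul_zero]
    · obtain ⟨h1, h2⟩ := toFockN_apply_ne_zero A n W h
      rw [Finset.card_compl, hΛ, hNdef] at h2
      have hle : (downPart s).card ≤ 2 * n := by rw [← hNdef, ← hΛ]; exact Finset.card_le_univ _
      have h3 : (downPart s).card = n := by omega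
      rw [h1, h3, sub_self, mul_zero, zero_mul]
  have hsec : ∀ ψ ∈ V, HubbardWave0.spinZ *ᵥ ψ = 0 → toFockN A n (resMatrix n (ofFock A ψ)) = ψ := by
    intro ψ hψ hZ
    apply toFockN_resMatrix_ofFock
    intro s hs
    have hcard : s.card = N := by by_contra h; exact hs (((hmemV ψ).1 hψ).2 s h)
    have hz := congrFun hZ s
    rw [spinZ_mulVec_apply, Pi.zero_apply, mul_eq_zero, mul_eq_zero] at hz
    rcases hz with (hz | hz) | hz
    · norm_num at hz
    · rw [sub_eq_zero] at hz
      have hz' : (upPart s).card = (downPart s).card := by exact_mod_cast hz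
      rw [← pairSet_upPart_downPart s, card_pairSet, hNdef] at hcard
      rw [Finset.card_compl, hΛ, hNdef]
      omega
    · exact absurd hz hs
  have heig : ∀ W, toFockN A n W ∈ V → LM *ᵥ vec W = ((E₀ - U * n : ℝ) : ℂ) • vec W := by
    intro W hW
    rw [hmemV] at hW
    have h1 := hW.1
    rw [hΦH] at h1
    have h2 : toFockN A n (Literature.MathematicalPhysics.QuantumLattice.liebOp (liebK G t n) (fun x => Literature.MathematicalPhysics.QuantumLattice.SpinReflection.rdiag (occInd n x)) (-U) W) =
        toFockN A n (((E₀ - U * n : ℝ) : ℂ) • W) := by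
      rw [toFockN_smul]
      have hc : ((E₀ - U * n : ℝ) : ℂ) = (E₀ : ℂ) - (U : ℂ) * n := by push_cast; ring
      rw [hc, sub_smul]
      exact eq_sub_of_add_eq h1
    have h3 := toFockN_injective A n h2
    rw [hLM, Literature.MathematicalPhysics.QuantumLattice.SpinReflection.liebMatrix_mulVec_vec hT.2, h3, vec_smul]
  -- the ground energies coincide: `E₀ = e + U n`
  have hW₀ne : W₀ ≠ 0 := by
    intro h
    have := hW₀pd.diag_pos (i := ⟨α₀, hα₀⟩)
    rw [h] at this
    exact lt_irrefl _ this
  have hψ₀ne : ψ₀ ≠ 0 := fun h => hW₀ne (toFockN_injective A n (by rw [← hψ₀def, h, toFockN_zero]))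
  have hliebOpW₀ : Literature.MathematicalPhysics.QuantumLattice.liebOp (liebK G t n) (fun x => Literature.MathematicalPhysics.QuantumLattice.SpinReflection.rdiag (occInd n x)) (-U) W₀ =
      (e : ℂ) • W₀ := (Literature.MathematicalPhysics.QuantumLattice.SpinReflection.mem_groundSpace_iff_liebOp hT.2 (occInd n) (-U) W₀).1 hW₀gs
  have hHψ₀ : H *ᵥ ψ₀ = ((e + U * n : ℝ) : ℂ) • ψ₀ := by
    rw [hψ₀def, hΦH, hliebOpW₀, toFockN_smul, ← add_smul]
    push_cast; rfl
  have hle : E₀ ≤ e + U * n := by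
    obtain ⟨c, -, hc1⟩ := Literature.MathematicalPhysics.QuantumLattice.exists_smul_unit hψ₀ne
    have hmem : c • ψ₀ ∈ Literature.MathematicalPhysics.QuantumLattice.nParticleSubmodule (ι := Orb Λ) N := Submodule.smul_mem _ c (hΦN W₀)
    have h := hvar (c • ψ₀) hmem hc1
    rw [mulVec_smul, hHψ₀, smul_comm, dotProduct_smul, hc1, smul_eq_mul, mul_one, Complex.ofReal_re] at h
    exact h
  have hge : e + U * n ≤ E₀ := by
    obtain ⟨φ, hφV, hφ0, hφZ⟩ := hC1 hVne
    set W := resMatrix n (ofFock A φ) with hWdef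
    have hφW : toFockN A n W = φ := hsec φ hφV hφZ
    have hWV : toFockN A n W ∈ V := by rw [hφW]; exact hφV
    have hLMW := heig W hWV
    have hW0 : vec W ≠ 0 := by
      intro h
      rw [← vec_zero, vec_inj] at h
      exact hφ0 (by rw [← hφW, h, toFockN_zero])
    obtain ⟨c, -, hc1⟩ := Literature.MathematicalPhysics.QuantumLattice.exists_smul_unit hW0
    have h := Matrix.groundEnergy_le_rayleigh_holds
      (Literature.MathematicalPhysics.QuantumLattice.SpinReflection.liebMatrix_isHermitian hT.1 (occInd n) (-U)) (c • vec W) hc1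
    rw [mulVec_smul, ← hLM, hLMW, smul_comm, dotProduct_smul, hc1, smul_eq_mul, mul_one, Complex.ofReal_re] at h
    change e ≤ E₀ - U * n at h
    linarith
  have hE : E₀ = e + U * n := le_antisymm hle hge
  -- the weight-zero line of `V`
  have hψ₀V : ψ₀ ∈ V := (hmemV ψ₀).2 ⟨by rw [hHψ₀, hE], hΦN W₀⟩
  have hψ₀Z : HubbardWave0.spinZ *ᵥ ψ₀ = 0 := hΦZ0 W₀
  have hW0line : ∀ ψ ∈ V, HubbardWave0.spinZ *ᵥ ψ = 0 → ∃ c : ℂ, ψ = c • ψ₀ := by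
    intro ψ hψ hZ
    set W := resMatrix n (ofFock A ψ) with hWdef
    have hψW : toFockN A n W = ψ := hsec ψ hψ hZ
    have hWV : toFockN A n W ∈ V := by rw [hψW]; exact hψ
    have hLMW := heig W hWV
    rw [hE, show ((e + U * n - U * n : ℝ) : ℂ) = (e : ℂ) by push_cast; ring] at hLMW
    have hgs : vec W ∈ LM.groundSpace := (Matrix.mem_groundSpace_iff _ _).2 hLMW
    obtain ⟨c, hc⟩ := huniq _ hgs
    refine ⟨c, ?_⟩
    have hWc : W = c • W₀ := vec_inj.1 (by rw [hc, vec_smul])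
    rw [← hψW, hWc, toFockN_smul]
  -- the spin of `ψ₀` from the overlap with the reference state
  have hS2ψ₀ : spinSq *ᵥ ψ₀ = ((J : ℂ) * (J + 1)) • ψ₀ := by
    have hmem : spinSq *ᵥ ψ₀ ∈ V := by
      rw [spinSq, add_mulVec, smul_mulVec, add_mulVec, ← mulVec_mulVec, ← mulVec_mulVec, ← mulVec_mulVec]
      exact V.add_mem (hZV _ (hZV _ hψ₀V)) (V.smul_mem _ (V.add_mem (hPV _ (hMV _ hψ₀V)) (hMV _ (hPV _ hψ₀V))))
    have hZ : HubbardWave0.spinZ *ᵥ (spinSq *ᵥ ψ₀) = 0 := by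
      rw [mulVec_mulVec, ← su2Casimir_spin_eq_spinSq, ← isSu2Triple_spin.su2Casimir_mul_Z, ← mulVec_mulVec, hψ₀Z,
        mulVec_zero]
    obtain ⟨c, hc⟩ := hW0line _ hmem hZ
    have hov : star (refState A n J) ⬝ᵥ ψ₀ ≠ 0 := refState_overlap_ne_zero A n J hW₀pd
    have h1 : star (refState A n J) ⬝ᵥ (spinSq *ᵥ ψ₀) = ((J : ℂ) * (J + 1)) * (star (refState A n J) ⬝ᵥ ψ₀) := by
      rw [dotProduct_mulVec, show star (refState A n J) ᵥ* spinSq = star (spinSq *ᵥ refState A n J) by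
        rw [star_mulVec, spinSq_conjTranspose], spinSq_mulVec_refState A hΛ hAJ, star_smul, smul_dotProduct,
        smul_eq_mul]
      congr 1
      simp
    rw [hc, dotProduct_smul, smul_eq_mul] at h1
    have hcJ : c = (J : ℂ) * (J + 1) := mul_right_cancel₀ hov h1
    rw [hc, hcJ]
  obtain ⟨hrank, hCV⟩ := hC2 ψ₀ J hψ₀V hψ₀ne hψ₀Z hW0line (by rw [su2Casimir_spin_eq_spinSq]; exact hS2ψ₀)
  exact ⟨hrank, fun ψ hψ => by rw [← su2Casimir_spin_eq_spinSq]; exact hCV ψ hψ⟩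

end Assembly

section Discharge

variable {Λ : Type*} [LinearOrder Λ] [Fintype Λ] (G : SimpleGraph Λ) [DecidableRel G.Adj]

/-- Lieb's spin is symmetric in the two colour classes. [folklore] -/
theorem liebSpin_compl (A : Finset Λ) : liebSpin Aᶜ = liebSpin A := by
  unfold liebSpin; rw [compl_compl, abs_sub_comm]

/-- For `|Λ| = 2n`, `|A| + J = n`: `liebSpin A = J`. [folklore] -/
theorem liebSpin_eq (A : Finset Λ) {n J : ℕ} (hΛ : Fintype.card Λ = 2 * n) (hAJ : A.card + J = n) :
    liebSpin A = J := by
  unfold liebSpin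
  rw [Finset.card_compl, hΛ, Nat.cast_sub (by omega)]
  have h : ((A.card : ℝ) - ((2 * n : ℕ) - A.card)) = -(2 * J) := by
    have : (A.card : ℝ) + J = n := by exact_mod_cast hAJ
    push_cast; linarith
  rw [h, abs_neg, abs_of_nonneg (by positivity)]
  ring

end Discharge

end Literature.MathematicalPhysics.QuantumLattice.LiebTwo

namespace Literature.MathematicalPhysics.QuantumLattice

open Matrix Finset LiebTwo
open scoped ComplexOrder

variable {Λ : Type*} [LinearOrder Λ] [Fintype Λ] (G : SimpleGraph Λ) [DecidableRel G.Adj]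

/-- **Discharge of `lieb_repulsive_halfFilling`** (Lieb's Theorem 2, repulsive half-filled case):
for `U > 0`, `t ≠ 0`, `|Λ|` even, `G` connected and bipartite with colour class `A`, at half
filling every ground state has `S² ψ = S(S+1) ψ` with `S = ||A| - |B||/2`, and the ground
eigenspace of the `N = |Λ|`-particle sector has dimension `2S + 1`. The colour class is normalised
to `|A| ≤ |B|` (`liebSpin_compl`) and `lieb_repulsive_halfFilling_core` is applied.
E. H. Lieb, Phys. Rev. Lett. 62 (1989) 1201, Theorem 2 (reprint: Montorsi (ed.), *The Hubbard
Model*, pp. 111–119). [cite: LiebPRL1989, Theorem 2] -/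
theorem lieb_repulsive_halfFilling_holds : lieb_repulsive_halfFilling G := by
  intro hG A hA hΛeven t U ht hU N hN
  obtain ⟨n, hn⟩ := hΛeven
  have hΛ : Fintype.card Λ = 2 * n := by rw [hn]; ring
  subst hN
  -- the statement for a colour class `B` with `|B| ≤ |Bᶜ|`
  have key : ∀ B : Finset Λ, (∀ x y : Λ, G.Adj x y → (x ∈ B ↔ y ∉ B)) → B.card ≤ Bᶜ.card →
      (∀ ψ : Fock (Orb Λ), IsGroundState (hamiltonian G t U) (Fintype.card Λ) ψ →
          spinSq *ᵥ ψ = ((liebSpin B * (liebSpin B + 1) : ℝ) : ℂ) • ψ) ∧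
        (Module.finrank ℂ
            ↥(LinearMap.ker (Matrix.toLin' (hamiltonian G t U -
                ((groundEnergy (hamiltonian G t U) (Fintype.card Λ) : ℝ) : ℂ) • 1)) ⊓
              LinearMap.ker (Matrix.toLin' (totalNumber - (Fintype.card Λ : ℂ) • (1 : Matrix _ _ ℂ)))) : ℝ) =
          2 * liebSpin B + 1 := by
    intro B hB hBle
    have hBc : B.card + Bᶜ.card = 2 * n := by rw [Finset.card_add_card_compl, hΛ]
    set J := n - B.card with hJ
    have hBJ : B.card + J = n := by omega
    have hspin : liebSpin B = J := liebSpin_eq B hΛ hBJ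
    obtain ⟨hrank, hS2⟩ := lieb_repulsive_halfFilling_core G hG B hB hΛ hBJ t U ht hU
    rw [hΛ]
    refine ⟨fun ψ hψ => ?_, ?_⟩
    · obtain ⟨hNψ, -, hHψ⟩ := hψ
      have hmem := (mem_groundSector_iff G t U (2 * n) (groundEnergy (hamiltonian G t U) (2 * n)) ψ).2 ⟨hHψ, hNψ⟩
      have h := hS2 ψ hmem
      rw [h, hspin]
      push_cast; rfl
    · rw [hrank, hspin]
      push_cast; ring
  rcases le_total A.card Aᶜ.card with h | h
  · exact key A hA h
  · have hA' : ∀ x y : Λ, G.Adj x y → (x ∈ Aᶜ ↔ y ∉ Aᶜ) := by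
      intro x y hxy
      rw [mem_compl, mem_compl, not_not]
      exact (not_congr (hA x y hxy)).trans not_not
    have h' : Aᶜ.card ≤ Aᶜᶜ.card := by rwa [compl_compl]
    have := key Aᶜ hA' h'
    rwa [liebSpin_compl] at this

end Literature.MathematicalPhysics.QuantumLattice
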